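import Mathlib
import HarnessLib
import Summits.Ventures.LatticeQCDFlow.Scaling.MixedPowerCostExponent
import Summits.Ventures.LatticeQCDFlow.Scoring.ScalingExponentFit

/-!
# MixedPowerFitExponent — the N-point log–log least-squares exponent is a convex combination of
# the pairwise secant exponents; for a mixed power law it lies in `[pmin, pmax]`, the secant
# exponents INCREASE towards finer spacings (Hölder), and the three-point fit lies between the
# coarse-pair and the fine-pair exponents (row 19's "exponent of cost vs `a`" reading rule)

HONEST FRAMING: exact (Metropolis-corrected) sampling algorithms for lattice gauge theory;
figures of merit are autocorrelation/cost numbers at stated couplings and volumes; no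
continuum-physics claim.

Venture `LatticeQCDFlow` (cell pub-lqcd), topic `Scaling`; FANOUT row 19 (`su2-snf`, GEN-5;
deliverable "exponent of cost vs `a` at fixed ESS", fitted through THREE spacings F1/F2/F3 with
the weighted log–log least squares of `Scoring/ScalingExponentFit` — row 27's `exponent_fit.py`).
OUR WORK, elementary real algebra; nothing is cited as a fact.  GEN-4's
`Scaling/MixedPowerCostExponent` settled what a TWO-spacing exponent of E7's mixed law
`C(x) = Σ_i k_i x^{p_i}` (`x = 1/a`, `k_i ≥ 0`; arXiv:2510.25704 §5: `k₀x³ + k₁x²` in step units)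
can be — it lies in `[pmin, pmax]` — and said "NOT CLAIMED: anything about three-point fits".
This file closes that:

* `two_mul_fitNum` — Lagrange's identity for the NUMERATOR of the fitted slope:
  `2(S₀S_xy − SₓS_y) = Σᵢⱼ wᵢwⱼ(xᵢ − xⱼ)(yᵢ − yⱼ)`; with `2Δ = Σᵢⱼ wᵢwⱼ(xᵢ − xⱼ)²`
  (`Scoring.two_mul_fitDet`) the weighted least-squares slope is the `wᵢwⱼ(xᵢ − xⱼ)²`-weighted
  AVERAGE OF THE PAIRWISE SLOPES `(yᵢ − yⱼ)/(xᵢ − xⱼ)`;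
* **`fitSlope_mem_Icc_of_pairSlopes`** — hence (non-negative weights, `Δ > 0`) if every pairwise
  slope lies in `[a, b]`, so does the fitted slope;
* `secantExponent_symm`, `secantExponent_eq_sub_div` — bookkeeping (the pairwise slope of
  `(log xᵢ, log C(xᵢ))` IS the two-spacing exponent `secantExponent C xⱼ xᵢ`);
* **`fitSlope_loglog_mixedPowerCost_mem_Icc`** — for a mixed power law with `k ≥ 0` and
  `p_i ∈ [pmin, pmax]`, the exponent fitted through ANY number of positive scales with ANY
  non-negative weights lies in `[pmin, pmax]` (E7 step units: `[2, 3]`; link units: `[6, 7]`);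
* **`mixedPowerCost_geom_le`** (Hölder / weighted AM–GM) — `C(x₁^{1−t}x₃^{t}) ≤ C(x₁)^{1−t}C(x₃)^t`:
  a mixed power law with non-negative amplitudes is LOG-LOG-CONVEX; hence
  **`secantExponent_three_chord`** — for `0 < x₁ < x₂ < x₃`:
  `p(x₁,x₂) ≤ p(x₁,x₃) ≤ p(x₂,x₃)` — TWO-SPACING EXPONENTS INCREASE TOWARDS FINER SPACINGS;
* **`fitSlope_three_points_mem_Icc`** — THE READING RULE: through three spacings the fitted
  exponent lies between the coarse-pair exponent `p(F1,F2)` and the fine-pair exponent `p(F2,F3)`.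

Contrapositive, in words (the drift certificate sharpened): measured secant exponents that
DECREASE towards finer spacing (`p̂(F1,F2) > p̂(F2,F3)` beyond errors), or a three-point fit outside
`[p̂(F1,F2), p̂(F2,F3)]`, certify that the amplitudes are not spacing-independent (family C: E7's
residual `K(β)` / the measured `k′_W(2.50) ≠ k′_W(2.60)`), whatever the powers.  NOT CLAIMED: that
the costs follow a mixed law; any value of `k_i`, `p_i`; error propagation (`Scoring.sum_fitCoef_sq_div`
is the variance formula; pairwise exponents of noisy data are correlated).
-/

namespace Summit.Ventures.LatticeQCDFlow.Scaling

open Finset Real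
open Summit.Ventures.LatticeQCDFlow.Scoring

/-! ## The fitted slope is an average of pairwise slopes -/

section PairwiseSlopes

variable {κ : Type*} (t : Finset κ) (w u y : κ → ℝ)

/-- **Lagrange's identity for the numerator**: `2(S₀S_xy − SₓS_y) = Σᵢⱼ wᵢwⱼ(uᵢ − uⱼ)(yᵢ − yⱼ)`. -/
theorem two_mul_fitNum :
    2 * (fitS0 t w * fitSxy t w u y - fitSx t w u * fitSy t w y)
      = ∑ i ∈ t, ∑ j ∈ t, w i * w j * ((u i - u j) * (y i - y j)) := by
  have e1 : fitS0 t w * fitSxy t w u y = ∑ i ∈ t, ∑ j ∈ t, w i * (w j * (u j * y j)) := by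
    rw [fitS0, fitSxy, Finset.sum_mul_sum]
  have e1' : fitSxy t w u y * fitS0 t w = ∑ i ∈ t, ∑ j ∈ t, w i * (u i * y i) * w j := by
    rw [fitS0, fitSxy, Finset.sum_mul_sum]
  have e2 : fitSx t w u * fitSy t w y = ∑ i ∈ t, ∑ j ∈ t, w i * u i * (w j * y j) := by
    rw [fitSx, fitSy, Finset.sum_mul_sum]
  have e2' : fitSy t w y * fitSx t w u = ∑ i ∈ t, ∑ j ∈ t, w i * y i * (w j * u j) := by
    rw [fitSx, fitSy, Finset.sum_mul_sum]
  have h : 2 * (fitS0 t w * fitSxy t w u y - fitSx t w u * fitSy t w y)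
      = fitS0 t w * fitSxy t w u y + fitSxy t w u y * fitS0 t w
        - (fitSx t w u * fitSy t w y + fitSy t w y * fitSx t w u) := by ring
  rw [h, e1, e1', e2, e2', ← sum_add_distrib, ← sum_add_distrib, ← sum_sub_distrib]
  refine sum_congr rfl fun i _ => ?_
  rw [← sum_add_distrib, ← sum_add_distrib, ← sum_sub_distrib]
  exact sum_congr rfl fun j _ => by ring

/-- **The fitted slope lies between the extreme pairwise slopes.**  Non-negative weights, `Δ > 0`
(two distinct abscissae carry weight), and every pairwise slope `(yᵢ − yⱼ)/(uᵢ − uⱼ)` (`uᵢ ≠ uⱼ`)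
in `[a, b]` ⇒ `fitSlope ∈ [a, b]`: the least-squares slope is the `wᵢwⱼ(uᵢ − uⱼ)²`-weighted mean
of the pairwise slopes. -/
theorem fitSlope_mem_Icc_of_pairSlopes {a b : ℝ} (hw : ∀ i ∈ t, 0 ≤ w i)
    (hD : 0 < fitDet t w u)
    (ha : ∀ i ∈ t, ∀ j ∈ t, u i ≠ u j → a ≤ (y i - y j) / (u i - u j))
    (hb : ∀ i ∈ t, ∀ j ∈ t, u i ≠ u j → (y i - y j) / (u i - u j) ≤ b) :
    fitSlope t w u y ∈ Set.Icc a b := by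
  have key : ∀ i ∈ t, ∀ j ∈ t, a * (u i - u j) ^ 2 ≤ (u i - u j) * (y i - y j)
      ∧ (u i - u j) * (y i - y j) ≤ b * (u i - u j) ^ 2 := by
    intro i hi j hj
    by_cases hu : u i = u j
    · simp [hu]
    · have hne : u i - u j ≠ 0 := sub_ne_zero.mpr hu
      have e : (u i - u j) * (y i - y j) = (y i - y j) / (u i - u j) * (u i - u j) ^ 2 := by
        field_simp
      rw [e]
      exact ⟨mul_le_mul_of_nonneg_right (ha i hi j hj hu) (sq_nonneg _),
        mul_le_mul_of_nonneg_right (hb i hi j hj hu) (sq_nonneg _)⟩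
  have hN := two_mul_fitNum t w u y
  have hΔ := two_mul_fitDet t w u
  have hlo : a * (2 * fitDet t w u)
      ≤ 2 * (fitS0 t w * fitSxy t w u y - fitSx t w u * fitSy t w y) := by
    rw [hΔ, hN, mul_sum]
    refine sum_le_sum fun i hi => ?_
    rw [mul_sum]
    refine sum_le_sum fun j hj => ?_
    have hww : 0 ≤ w i * w j := mul_nonneg (hw i hi) (hw j hj)
    calc a * (w i * w j * (u i - u j) ^ 2) = w i * w j * (a * (u i - u j) ^ 2) := by ring
      _ ≤ w i * w j * ((u i - u j) * (y i - y j)) :=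
          mul_le_mul_of_nonneg_left (key i hi j hj).1 hww
  have hhi : 2 * (fitS0 t w * fitSxy t w u y - fitSx t w u * fitSy t w y)
      ≤ b * (2 * fitDet t w u) := by
    rw [hΔ, hN, mul_sum]
    refine sum_le_sum fun i hi => ?_
    rw [mul_sum]
    refine sum_le_sum fun j hj => ?_
    have hww : 0 ≤ w i * w j := mul_nonneg (hw i hi) (hw j hj)
    calc w i * w j * ((u i - u j) * (y i - y j)) ≤ w i * w j * (b * (u i - u j) ^ 2) :=
          mul_le_mul_of_nonneg_left (key i hi j hj).2 hww
      _ = b * (w i * w j * (u i - u j) ^ 2) := by ring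
  unfold fitSlope
  constructor
  · rw [le_div_iff₀ hD]; linarith
  · rw [div_le_iff₀ hD]; linarith

end PairwiseSlopes

/-! ## Log–log fits of a mixed power law -/

section MixedPower

variable {ι : Type*} (s : Finset ι) {k p : ι → ℝ}

/-- The two-point exponent is symmetric in the two scales. -/
theorem secantExponent_symm (C : ℝ → ℝ) (x₁ x₂ : ℝ) :
    secantExponent C x₂ x₁ = secantExponent C x₁ x₂ := by
  unfold secantExponent
  rw [show C x₁ / C x₂ = (C x₂ / C x₁)⁻¹ by rw [inv_div],
    show x₁ / x₂ = (x₂ / x₁)⁻¹ by rw [inv_div], Real.log_inv, Real.log_inv, neg_div_neg_eq]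

/-- As a slope in the log–log plane: `p(x₁,x₂) = (log C x₂ − log C x₁)/(log x₂ − log x₁)`. -/
theorem secantExponent_eq_sub_div (C : ℝ → ℝ) {x₁ x₂ : ℝ} (hx₁ : 0 < x₁) (hx₂ : 0 < x₂)
    (hC₁ : 0 < C x₁) (hC₂ : 0 < C x₂) :
    secantExponent C x₁ x₂
      = (Real.log (C x₂) - Real.log (C x₁)) / (Real.log x₂ - Real.log x₁) := by
  unfold secantExponent
  rw [Real.log_div hC₂.ne' hC₁.ne', Real.log_div hx₂.ne' hx₁.ne']

/-- A mixed power law with non-negative amplitudes, one of them positive, is positive at every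
positive scale. -/
theorem mixedPowerCost_pos (hk : ∀ i ∈ s, 0 ≤ k i) {i₀ : ι} (hi₀ : i₀ ∈ s) (hk₀ : 0 < k i₀)
    {x : ℝ} (hx : 0 < x) : 0 < mixedPowerCost s k p x :=
  sum_pos' (fun i hi => mul_nonneg (hk i hi) (Real.rpow_nonneg hx.le _))
    ⟨i₀, hi₀, mul_pos hk₀ (Real.rpow_pos_of_pos hx _)⟩

/-- Positivity propagates across scales: positive cost at one positive scale (so some amplitude
is positive) gives positive cost at every positive scale. -/
theorem mixedPowerCost_pos_of_pos (hk : ∀ i ∈ s, 0 ≤ k i) {x₁ x : ℝ}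
    (hC₁ : 0 < mixedPowerCost s k p x₁) (hx : 0 < x) : 0 < mixedPowerCost s k p x := by
  obtain ⟨i, hi, hlt⟩ := Finset.exists_lt_of_sum_lt (s := s) (f := fun _ => (0:ℝ))
    (g := fun i => k i * x₁ ^ p i) (by simpa [mixedPowerCost] using hC₁)
  have hki : 0 < k i := lt_of_le_of_ne (hk i hi) fun h => by
    rw [← h, zero_mul] at hlt
    exact lt_irrefl _ hlt
  exact mixedPowerCost_pos s hk hi hki hx

/-- **The N-point log–log exponent of a mixed power law lies in `[pmin, pmax]`.**  Powers
`p_i ∈ [pmin, pmax]`, amplitudes `k_i ≥ 0`, data at positive scales `X a` (`a ∈ t`) where the cost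
is positive, non-negative weights with `Δ > 0`: the weighted least-squares slope of
`log C(X a)` on `log X a` lies in `[pmin, pmax]`. -/
theorem fitSlope_loglog_mixedPowerCost_mem_Icc {κ : Type*} (t : Finset κ) (w X : κ → ℝ)
    {pmin pmax : ℝ} (hk : ∀ i ∈ s, 0 ≤ k i) (hpmin : ∀ i ∈ s, pmin ≤ p i)
    (hpmax : ∀ i ∈ s, p i ≤ pmax) (hX : ∀ a ∈ t, 0 < X a)
    (hC : ∀ a ∈ t, 0 < mixedPowerCost s k p (X a)) (hw : ∀ a ∈ t, 0 ≤ w a)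
    (hD : 0 < fitDet t w (fun a => Real.log (X a))) :
    fitSlope t w (fun a => Real.log (X a)) (fun a => Real.log (mixedPowerCost s k p (X a)))
      ∈ Set.Icc pmin pmax := by
  have hpair : ∀ a ∈ t, ∀ b ∈ t, Real.log (X a) ≠ Real.log (X b) →
      (Real.log (mixedPowerCost s k p (X a)) - Real.log (mixedPowerCost s k p (X b)))
          / (Real.log (X a) - Real.log (X b)) ∈ Set.Icc pmin pmax := by
    intro a ha b hb hne
    have hXne : X a ≠ X b := fun h => hne (by rw [h])
    rw [← secantExponent_eq_sub_div _ (hX b hb) (hX a ha) (hC b hb) (hC a ha)]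
    rcases lt_or_gt_of_ne hXne with hlt | hgt
    · rw [secantExponent_symm]
      exact secantExponent_mem_Icc s hk hpmin hpmax (hX a ha) hlt (hC a ha)
    · exact secantExponent_mem_Icc s hk hpmin hpmax (hX b hb) hgt (hC b hb)
  exact fitSlope_mem_Icc_of_pairSlopes t w _ _ hw hD (fun a ha b hb hne => (hpair a ha b hb hne).1)
    (fun a ha b hb hne => (hpair a ha b hb hne).2)

/-- **Hölder / log–log convexity.**  For `k ≥ 0`, `x₁, x₃ > 0` with positive cost and
`0 ≤ t ≤ 1`: `C(x₁^{1−t}·x₃^{t}) ≤ C(x₁)^{1−t}·C(x₃)^{t}` (weighted AM–GM termwise after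
normalising by `C(x₁)`, `C(x₃)`). -/
theorem mixedPowerCost_geom_le (hk : ∀ i ∈ s, 0 ≤ k i) {x₁ x₃ t : ℝ} (hx₁ : 0 < x₁)
    (hx₃ : 0 < x₃) (ht0 : 0 ≤ t) (ht1 : t ≤ 1) (hC₁ : 0 < mixedPowerCost s k p x₁)
    (hC₃ : 0 < mixedPowerCost s k p x₃) :
    mixedPowerCost s k p (x₁ ^ (1 - t) * x₃ ^ t)
      ≤ mixedPowerCost s k p x₁ ^ (1 - t) * mixedPowerCost s k p x₃ ^ t := by
  set A := mixedPowerCost s k p x₁ with hA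
  set B := mixedPowerCost s k p x₃ with hB
  have hAB : 0 < A ^ (1 - t) * B ^ t := mul_pos (Real.rpow_pos_of_pos hC₁ _) (Real.rpow_pos_of_pos hC₃ _)
  -- termwise: (x₁^{1−t} x₃^t)^p = (x₁^p)^{1−t} (x₃^p)^t
  have hterm : ∀ i, (x₁ ^ (1 - t) * x₃ ^ t) ^ p i = (x₁ ^ p i) ^ (1 - t) * (x₃ ^ p i) ^ t := by
    intro i
    rw [Real.mul_rpow (Real.rpow_nonneg hx₁.le _) (Real.rpow_nonneg hx₃.le _),
      ← Real.rpow_mul hx₁.le, ← Real.rpow_mul hx₃.le, mul_comm (1 - t) (p i), mul_comm t (p i),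
      Real.rpow_mul hx₁.le, Real.rpow_mul hx₃.le]
  -- normalised variables
  have hai : ∀ i, 0 ≤ x₁ ^ p i / A := fun i => div_nonneg (Real.rpow_nonneg hx₁.le _) hC₁.le
  have hbi : ∀ i, 0 ≤ x₃ ^ p i / B := fun i => div_nonneg (Real.rpow_nonneg hx₃.le _) hC₃.le
  have hnorm : ∀ i, (x₁ ^ p i) ^ (1 - t) * (x₃ ^ p i) ^ t
      = A ^ (1 - t) * B ^ t * ((x₁ ^ p i / A) ^ (1 - t) * (x₃ ^ p i / B) ^ t) := by
    intro i
    rw [Real.div_rpow (Real.rpow_nonneg hx₁.le _) hC₁.le,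
      Real.div_rpow (Real.rpow_nonneg hx₃.le _) hC₃.le]
    have hA' : A ^ (1 - t) ≠ 0 := (Real.rpow_pos_of_pos hC₁ _).ne'
    have hB' : B ^ t ≠ 0 := (Real.rpow_pos_of_pos hC₃ _).ne'
    field_simp
  have hyoung : ∀ i, (x₁ ^ p i / A) ^ (1 - t) * (x₃ ^ p i / B) ^ t
      ≤ (1 - t) * (x₁ ^ p i / A) + t * (x₃ ^ p i / B) := fun i =>
    Real.geom_mean_le_arith_mean2_weighted (by linarith) ht0 (hai i) (hbi i) (by ring)
  have hsumA : ∑ i ∈ s, k i * (x₁ ^ p i / A) = 1 := by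
    simp_rw [mul_div_assoc', ← sum_div]
    exact div_self hC₁.ne'
  have hsumB : ∑ i ∈ s, k i * (x₃ ^ p i / B) = 1 := by
    simp_rw [mul_div_assoc', ← sum_div]
    exact div_self hC₃.ne'
  calc mixedPowerCost s k p (x₁ ^ (1 - t) * x₃ ^ t)
      = ∑ i ∈ s, k i * ((x₁ ^ p i) ^ (1 - t) * (x₃ ^ p i) ^ t) := by
        unfold mixedPowerCost
        exact sum_congr rfl fun i _ => by rw [hterm i]
    _ = A ^ (1 - t) * B ^ t
          * ∑ i ∈ s, k i * ((x₁ ^ p i / A) ^ (1 - t) * (x₃ ^ p i / B) ^ t) := by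
        rw [mul_sum]
        exact sum_congr rfl fun i _ => by rw [hnorm i]; ring
    _ ≤ A ^ (1 - t) * B ^ t
          * ∑ i ∈ s, k i * ((1 - t) * (x₁ ^ p i / A) + t * (x₃ ^ p i / B)) := by
        refine mul_le_mul_of_nonneg_left (sum_le_sum fun i hi => ?_) hAB.le
        exact mul_le_mul_of_nonneg_left (hyoung i) (hk i hi)
    _ = A ^ (1 - t) * B ^ t := by
        have e : ∑ i ∈ s, k i * ((1 - t) * (x₁ ^ p i / A) + t * (x₃ ^ p i / B))
            = (1 - t) * ∑ i ∈ s, k i * (x₁ ^ p i / A) + t * ∑ i ∈ s, k i * (x₃ ^ p i / B) := by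
          rw [mul_sum, mul_sum, ← sum_add_distrib]
          exact sum_congr rfl fun i _ => by ring
        rw [e, hsumA, hsumB]
        ring

/-- **THE THREE-CHORD INEQUALITY: two-spacing exponents increase towards finer spacings.**  For
`k ≥ 0`, `0 < x₁ < x₂ < x₃` and positive cost at `x₁`:
`p(x₁,x₂) ≤ p(x₁,x₃) ≤ p(x₂,x₃)`. -/
theorem secantExponent_three_chord (hk : ∀ i ∈ s, 0 ≤ k i) {x₁ x₂ x₃ : ℝ} (hx₁ : 0 < x₁)
    (h12 : x₁ < x₂) (h23 : x₂ < x₃) (hC₁ : 0 < mixedPowerCost s k p x₁) :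
    secantExponent (mixedPowerCost s k p) x₁ x₂ ≤ secantExponent (mixedPowerCost s k p) x₁ x₃
      ∧ secantExponent (mixedPowerCost s k p) x₁ x₃
          ≤ secantExponent (mixedPowerCost s k p) x₂ x₃ := by
  have hx₂ : 0 < x₂ := hx₁.trans h12
  have hx₃ : 0 < x₃ := hx₂.trans h23
  have hC₂ : 0 < mixedPowerCost s k p x₂ := mixedPowerCost_pos_of_pos s hk hC₁ hx₂
  have hC₃ : 0 < mixedPowerCost s k p x₃ := mixedPowerCost_pos_of_pos s hk hC₁ hx₃
  set L₁ := Real.log x₂ - Real.log x₁ with hL₁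
  set L₂ := Real.log x₃ - Real.log x₂ with hL₂
  set L := Real.log x₃ - Real.log x₁ with hL
  have hL₁0 : 0 < L₁ := sub_pos.mpr (Real.log_lt_log hx₁ h12)
  have hL₂0 : 0 < L₂ := sub_pos.mpr (Real.log_lt_log hx₂ h23)
  have hLsum : L = L₁ + L₂ := by rw [hL, hL₁, hL₂]; ring
  have hL0 : 0 < L := by rw [hLsum]; exact add_pos hL₁0 hL₂0
  set t := L₁ / L with ht
  have ht0 : 0 ≤ t := div_nonneg hL₁0.le hL0.le
  have ht1 : t ≤ 1 := (div_le_one hL0).mpr (by rw [hLsum]; linarith)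
  have h1t : 1 - t = L₂ / L := by
    rw [ht, eq_div_iff hL0.ne', sub_mul, div_mul_cancel₀ _ hL0.ne', one_mul, hLsum]; ring
  -- the geometric interpolation point IS x₂
  have hgeom : x₁ ^ (1 - t) * x₃ ^ t = x₂ := by
    have hpos : 0 < x₁ ^ (1 - t) * x₃ ^ t :=
      mul_pos (Real.rpow_pos_of_pos hx₁ _) (Real.rpow_pos_of_pos hx₃ _)
    refine Real.log_injOn_pos (Set.mem_Ioi.mpr hpos) (Set.mem_Ioi.mpr hx₂) ?_
    rw [Real.log_mul (Real.rpow_pos_of_pos hx₁ _).ne' (Real.rpow_pos_of_pos hx₃ _).ne',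
      Real.log_rpow hx₁, Real.log_rpow hx₃, h1t, ht]
    rw [div_mul_eq_mul_div, div_mul_eq_mul_div, ← add_div, div_eq_iff hL0.ne']
    rw [hL, hL₁, hL₂]
    ring
  -- Hölder at x₂, in logarithms
  have hH := mixedPowerCost_geom_le s hk hx₁ hx₃ ht0 ht1 hC₁ hC₃
  rw [hgeom] at hH
  have hlog : Real.log (mixedPowerCost s k p x₂)
      ≤ (1 - t) * Real.log (mixedPowerCost s k p x₁) + t * Real.log (mixedPowerCost s k p x₃) := by
    have h := Real.log_le_log hC₂ hH
    rwa [Real.log_mul (Real.rpow_pos_of_pos hC₁ _).ne' (Real.rpow_pos_of_pos hC₃ _).ne',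
      Real.log_rpow hC₁, Real.log_rpow hC₃] at h
  set g₁ := Real.log (mixedPowerCost s k p x₁)
  set g₂ := Real.log (mixedPowerCost s k p x₂)
  set g₃ := Real.log (mixedPowerCost s k p x₃)
  rw [secantExponent_eq_sub_div _ hx₁ hx₂ hC₁ hC₂, secantExponent_eq_sub_div _ hx₁ hx₃ hC₁ hC₃,
    secantExponent_eq_sub_div _ hx₂ hx₃ hC₂ hC₃]
  change (g₂ - g₁) / L₁ ≤ (g₃ - g₁) / L ∧ (g₃ - g₁) / L ≤ (g₃ - g₂) / L₂
  have htL : t * L = L₁ := by rw [ht, div_mul_cancel₀ _ hL0.ne']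
  have h1tL : (1 - t) * L = L₂ := by rw [h1t, div_mul_cancel₀ _ hL0.ne']
  constructor
  · -- g₂ − g₁ ≤ t (g₃ − g₁) = (L₁/L)(g₃ − g₁)
    rw [div_le_div_iff₀ hL₁0 hL0]
    have : g₂ - g₁ ≤ t * (g₃ - g₁) := by linarith
    calc (g₂ - g₁) * L ≤ t * (g₃ - g₁) * L := mul_le_mul_of_nonneg_right this hL0.le
      _ = (g₃ - g₁) * L₁ := by rw [← htL]; ring
  · rw [div_le_div_iff₀ hL0 hL₂0]
    have : (1 - t) * (g₃ - g₁) ≤ g₃ - g₂ := by linarith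
    calc (g₃ - g₁) * L₂ = (1 - t) * (g₃ - g₁) * L := by rw [← h1tL]; ring
      _ ≤ (g₃ - g₂) * L := mul_le_mul_of_nonneg_right this hL0.le

/-- **THE THREE-POINT READING RULE.**  Data at three scales `0 < X 0 < X 1 < X 2` (coarse to
fine: `x = 1/a` at F1, F2, F3) lying on a mixed power law with `k ≥ 0`, any non-negative weights
with `Δ > 0`: the fitted exponent lies between the COARSE-PAIR and the FINE-PAIR exponents,
`p(X 0, X 1) ≤ ẑ ≤ p(X 1, X 2)`. -/
theorem fitSlope_three_points_mem_Icc (hk : ∀ i ∈ s, 0 ≤ k i) (w X : Fin 3 → ℝ)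
    (hX0 : 0 < X 0) (h01 : X 0 < X 1) (h12 : X 1 < X 2) (hC : 0 < mixedPowerCost s k p (X 0))
    (hw : ∀ a, 0 ≤ w a) (hD : 0 < fitDet univ w (fun a => Real.log (X a))) :
    fitSlope univ w (fun a => Real.log (X a)) (fun a => Real.log (mixedPowerCost s k p (X a)))
      ∈ Set.Icc (secantExponent (mixedPowerCost s k p) (X 0) (X 1))
          (secantExponent (mixedPowerCost s k p) (X 1) (X 2)) := by
  have hX1 : 0 < X 1 := hX0.trans h01
  have hX2 : 0 < X 2 := hX1.trans h12
  obtain ⟨c1, c2⟩ := secantExponent_three_chord s hk hX0 h01 h12 hC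
  have hXpos : ∀ a, 0 < X a := by
    intro a; fin_cases a <;> assumption
  have hCpos : ∀ a, 0 < mixedPowerCost s k p (X a) := fun a =>
    mixedPowerCost_pos_of_pos s hk hC (hXpos a)
  -- every pairwise exponent lies in [p(X0,X1), p(X1,X2)]
  have hpair : ∀ a b : Fin 3, X a < X b →
      secantExponent (mixedPowerCost s k p) (X a) (X b)
        ∈ Set.Icc (secantExponent (mixedPowerCost s k p) (X 0) (X 1))
            (secantExponent (mixedPowerCost s k p) (X 1) (X 2)) := by
    intro a b hab
    fin_cases a <;> fin_cases b
    all_goals first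
      | exact absurd hab (lt_irrefl _)
      | exact absurd hab (not_lt.mpr h01.le)
      | exact absurd hab (not_lt.mpr h12.le)
      | exact absurd hab (not_lt.mpr (h01.trans h12).le)
      | exact ⟨le_rfl, c1.trans c2⟩
      | exact ⟨c1, c2⟩
      | exact ⟨c1.trans c2, le_rfl⟩
  refine fitSlope_mem_Icc_of_pairSlopes univ w _ _ (fun a _ => hw a) hD
    (fun a _ b _ hne => ?_) (fun a _ b _ hne => ?_)
  all_goals
    have hXne : X a ≠ X b := fun h => hne (by rw [h])
    rw [← secantExponent_eq_sub_div _ (hXpos b) (hXpos a) (hCpos b) (hCpos a)]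
    rcases lt_or_gt_of_ne hXne with hlt | hgt
    · rw [secantExponent_symm (mixedPowerCost s k p) (X a) (X b)]
      first | exact (hpair a b hlt).1 | exact (hpair a b hlt).2
    · first | exact (hpair b a hgt).1 | exact (hpair b a hgt).2

end MixedPower

end Summit.Ventures.LatticeQCDFlow.Scaling
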